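/-
Copyright (c) 2026 the pub-hodgecm-mathlib formalisation cell (harness21).  Prover seat hodgecm-mathlib-K2E4-p11 (g6), Track B ∕ K2-LIT, h413 =
`stmt-HodgeConjecture-24833`, line `K2_E1_TraceFormulaBeta`, campaign «5Res (c) MS-2(χ,τ)», payer of the two regularity binders `h𝔥o`, `hΨ` of row 15
`K2E1ChiMaassSelbergFamilyCMTwo.exists_truncatedFamily_chi_cm_two` (TABLE 13th issue §F row 15; own block per R34 (ii)–(iii)): finite-dimensional linear algebra —
the inverse of a weakly holomorphic matrix family is holomorphic off the zero set of its determinant.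
-/
import Mathlib.LinearAlgebra.Dual.Lemmas
import Mathlib.LinearAlgebra.Determinant
import Mathlib.LinearAlgebra.Matrix.NonsingularInverse
import Mathlib.LinearAlgebra.Matrix.ToLin
import Mathlib.Analysis.Calculus.Deriv.Mul
import Mathlib.Analysis.Calculus.Deriv.Inv
import HarnessLib

/-!
# h413 ∕ Track B «K2-LIT», «MS-2(χ,τ)» — `K2E1ChiHeckeMatrixInverseHolomorphic`: THE INVERSE HECKE MATRIX `𝔥(z)⁻¹` IS HOLOMORPHIC WHERE `𝔥(z)` IS INVERTIBLE, AND
# `{z | 𝔥(z) invertible}` IS OPEN — the payer of the binders `h𝔥o`, `hΨ` of ★ row 15 `exists_truncatedFamily_chi_cm_two`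

Cell `pub/hodgecm-mathlib`, crux H413 = `stmt-HodgeConjecture-24833`, route `HCCMUnconditional`; TABLE 13th issue §F row 15 (dealer K2E1-plan (g6) deal (125)), own block (K2-lead R34).
THEOREMS ONLY (no `def` ∕ `instance` ∕ `notation` ∕ named-fact hypothesis ∕ `sorry`); lane `--kind proof --supports stmt-HodgeConjecture-24833 --as helper` (count-neutral; closes no socket).
Pure linear algebra over a nontrivially normed field `𝕜` (used at `𝕜 = ℂ`); rank-free, group-free.

THE MATHEMATICS ([BernsteinLapid2019, §4 Claim 1 (p. 9): «the operators depend holomorphically on `s`»]; [MoeglinWaldspurger1995, I.2.17, IV.1.3]).  The Hecke matrix of a test function on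
a finite-dimensional section space `V ≤ (G(𝔸) → ℂ)` is given (★ p859566 `exists_heckeEnd_cm`) as `𝔥 : ℂ → Module.End ℂ V` with POINTWISE holomorphy `z ↦ (𝔥 z ψ)(x)` for every
`ψ ∈ V`, `x ∈ G(𝔸)`.  (1) On a finite-dimensional space of functions the evaluation functionals span the dual (their common kernel is `0`; `W^{00} = W` for `W ≤ V^*`, Mathlib
`Subspace.dualCoannihilator_dualAnnihilator_eq`), so pointwise holomorphy is WEAK holomorphy: `z ↦ ℓ(f z)` is holomorphic for every `ℓ ∈ V^*` (§1).  (2) In a basis `b` the matrix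
entries `b^*_i(𝔥(z) b_j)` are then holomorphic, hence so is `det 𝔥(z)` (Leibniz expansion — a polynomial in the entries) and every entry of the adjugate (determinants of the same
kind); `𝔥(z)` is invertible iff `det 𝔥(z) ≠ 0` (Mathlib `LinearMap.isUnit_iff_isUnit_det`), an OPEN condition, and there `𝔥(z)⁻¹ = det⁻¹ · adj` (Cramer ∕ Mathlib `Matrix.inv_def`) has
holomorphic entries (§2).  (3) Consequently for a linear unknown `Ψ(z) : V →ₗ X` into a normed space, holomorphic vectorwise on `U`, the map `z ↦ Ψ(z)(𝔥(z)⁻¹ φ) =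
Σ_i c_i(z) · Ψ(z)(b_i)` (`c(z) = 𝔥(z)⁻¹`-coordinates of `φ`) is holomorphic on `U ∩ {𝔥(z) invertible}` (§3) — the binders `h𝔥o`, `hΨ` of ★ row 15, discharged from
`[FiniteDimensional ℂ V]` + ★ p859566's entrywise holomorphy + vectorwise holomorphy of `Ψ`.
* §1 `differentiableOn_dual_apply_of_eval` (function spaces: pointwise ⇒ weak holomorphy), `span_range_eval_eq_top`.
* §2 `differentiableOn_matrix_det` (Leibniz), `differentiableOn_toMatrix_apply`, `differentiableOn_det`, `isUnit_iff_det_toMatrix_ne_zero`, **`isOpen_setOf_isUnit`**,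
  `toMatrix_inverse_eq`, `differentiableOn_adjugate_toMatrix_apply`, **`differentiableOn_coord_inverse_apply`** (the coordinates of `𝔥(z)⁻¹ φ`).
* §3 **`differentiableOn_apply_inverse_apply`** (`z ↦ Ψ(z)(Ring.inverse (𝔥 z) φ)` on `U ∩ {IsUnit (𝔥 z)}`) and the function-space prints **`isOpen_setOf_isUnit_of_eval`**,
  **`differentiableOn_apply_inverse_apply_of_eval`** in EXACTLY the hypotheses ★ p859566 delivers (`∀ ψ x, Differentiable 𝕜 fun z => (𝔥 z ψ) x`).
HONEST LABEL.  Count-neutral helper; proves no printed statement; HC_CM is proved only modulo the 7 printed citations (2 remaining named inputs: hLiu418 = `stmt-HodgeConjecture-24832`,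
h413 = `stmt-HodgeConjecture-24833`) until rung 0 closes.

## References
* [BernsteinLapid2019] J. Bernstein, E. Lapid, *On the meromorphic continuation of Eisenstein series*, J. AMS 37 (2024) (arXiv:1911.02342), §4 Claim 1 (p. 9).
* [MoeglinWaldspurger1995] C. Mœglin, J.-L. Waldspurger, *Spectral decomposition and Eisenstein series* (1995), I.2.17, IV.1.3.
-/

set_option autoImplicit false
-- the mandated namespace repeats `HodgeConjecture.HodgeConjecture`, as in every `Theorems/*.lean` of this sub-problem
set_option linter.dupNamespace false

noncomputable section

open Set Filter Topology Matrix

namespace Summit.HodgeConjecture.HodgeConjecture.Cruxes.H413.K2E1ChiHeckeMatrixInverseHolomorphic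

/-! ## §1 Function spaces: the evaluation functionals span the dual; pointwise holomorphy ⇒ weak holomorphy -/

section Eval

variable {𝕜 : Type*} [NontriviallyNormedField 𝕜] {G : Type*}

/-- **On a finite-dimensional space `V` of functions `G → 𝕜` the evaluation functionals `ψ ↦ ψ(x)` span the dual `V^*`**: their common kernel is `0`, and `W^{00} = W` for
subspaces `W ≤ V^*` of the (finite-dimensional) dual. [folklore] [cite: MoeglinWaldspurger1995, I.2.17] -/
theorem span_range_eval_eq_top (V : Submodule 𝕜 (G → 𝕜)) [FiniteDimensional 𝕜 ↥V] :
    Submodule.span 𝕜 (Set.range fun x : G => (LinearMap.proj x).comp V.subtype : Set (Module.Dual 𝕜 ↥V)) = ⊤ := by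
  set W : Submodule 𝕜 (Module.Dual 𝕜 ↥V) := Submodule.span 𝕜 (Set.range fun x : G => (LinearMap.proj x).comp V.subtype) with hW
  have h0 : W.dualCoannihilator = ⊥ := by
    rw [Submodule.eq_bot_iff]
    intro v hv
    rw [Submodule.mem_dualCoannihilator] at hv
    refine Subtype.ext (funext fun x => ?_)
    have := hv ((LinearMap.proj x).comp V.subtype) (Submodule.subset_span ⟨x, rfl⟩)
    simpa using this
  have h1 := Subspace.dualCoannihilator_dualAnnihilator_eq (W := W)
  rw [h0, Submodule.dualAnnihilator_bot] at h1
  exact h1.symm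

/-- **POINTWISE HOLOMORPHY ⇒ WEAK HOLOMORPHY** on a finite-dimensional function space: if `z ↦ (f z)(x)` is differentiable on `U` for every point `x`, then `z ↦ ℓ(f z)` is differentiable
on `U` for every linear functional `ℓ ∈ V^*` (`ℓ` is a finite linear combination of evaluations). [folklore] [cite: BernsteinLapid2019, §4 Claim 1 (p. 9)] -/
theorem differentiableOn_dual_apply_of_eval (V : Submodule 𝕜 (G → 𝕜)) [FiniteDimensional 𝕜 ↥V] {f : 𝕜 → ↥V} {U : Set 𝕜}
    (hf : ∀ x : G, DifferentiableOn 𝕜 (fun z => ((f z : ↥V) : G → 𝕜) x) U) (ℓ : Module.Dual 𝕜 ↥V) :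
    DifferentiableOn 𝕜 (fun z => ℓ (f z)) U := by
  have hℓ : ℓ ∈ Submodule.span 𝕜 (Set.range fun x : G => (LinearMap.proj x).comp V.subtype : Set (Module.Dual 𝕜 ↥V)) := by
    rw [span_range_eval_eq_top V]; exact Submodule.mem_top
  induction hℓ using Submodule.span_induction with
  | mem φ hφ =>
    obtain ⟨x, rfl⟩ := hφ
    exact (hf x).congr fun z _ => by simp only [LinearMap.comp_apply, Submodule.subtype_apply, LinearMap.proj_apply]
  | zero => exact (differentiableOn_const (0 : 𝕜)).congr fun z _ => by simp only [LinearMap.zero_apply]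
  | add φ ψ _ _ h1 h2 => exact (h1.add h2).congr fun z _ => by simp only [LinearMap.add_apply, Pi.add_apply]
  | smul a φ _ h1 => exact (h1.const_smul a).congr fun z _ => by simp only [LinearMap.smul_apply, Pi.smul_apply]

end Eval

/-! ## §2 Abstract finite-dimensional `V`: determinant, invertibility, inverse coordinates of a weakly holomorphic `End V`-valued map -/

section FinDim

variable {𝕜 : Type*} [NontriviallyNormedField 𝕜] {ι : Type*} [Fintype ι] [DecidableEq ι]

/-- **LEIBNIZ: the determinant of a matrix with differentiable entries is differentiable** (`det A = Σ_σ sign σ · Π_i A (σ i) i`). [folklore] -/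
theorem differentiableOn_matrix_det {A : 𝕜 → Matrix ι ι 𝕜} {S : Set 𝕜} (hA : ∀ i j, DifferentiableOn 𝕜 (fun z => A z i j) S) :
    DifferentiableOn 𝕜 (fun z => (A z).det) S := by
  have h : (fun z => (A z).det) = fun z => ∑ σ : Equiv.Perm ι, ((Equiv.Perm.sign σ : ℤ) : 𝕜) * ∏ i, A z (σ i) i := by
    funext z; rw [Matrix.det_apply']
  rw [h]
  refine DifferentiableOn.fun_sum fun σ _ => ?_
  exact (DifferentiableOn.fun_finsetProd fun i _ => hA (σ i) i).const_mul _

/-- **The updated-row determinants (adjugate entries) of a matrix with differentiable entries are differentiable.** [folklore] -/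
theorem differentiableOn_matrix_adjugate_apply {A : 𝕜 → Matrix ι ι 𝕜} {S : Set 𝕜} (hA : ∀ i j, DifferentiableOn 𝕜 (fun z => A z i j) S) (i j : ι) :
    DifferentiableOn 𝕜 (fun z => (A z).adjugate i j) S := by
  have h : (fun z => (A z).adjugate i j) = fun z => ((A z).updateRow j (Pi.single i 1)).det := by
    funext z; rw [Matrix.adjugate_apply]
  rw [h]
  refine differentiableOn_matrix_det fun k l => ?_
  by_cases hk : k = j
  · subst hk
    simp only [Matrix.updateRow_self]
    exact differentiableOn_const _
  · simp only [Matrix.updateRow_ne hk]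
    exact hA k l

variable {V : Type*} [AddCommGroup V] [Module 𝕜 V]

/-- **Matrix entries of a weakly differentiable `End V`-valued map are differentiable** (`(toMatrix b b (𝔥 z)) i j = b^*_i (𝔥 z b_j)`). [folklore] -/
theorem differentiableOn_toMatrix_apply (b : Module.Basis ι 𝕜 V) {𝔥 : 𝕜 → Module.End 𝕜 V} {S : Set 𝕜}
    (h𝔥 : ∀ (ℓ : Module.Dual 𝕜 V) (v : V), DifferentiableOn 𝕜 (fun z => ℓ (𝔥 z v)) S) (i j : ι) :
    DifferentiableOn 𝕜 (fun z => LinearMap.toMatrix b b (𝔥 z) i j) S := by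
  have h : (fun z => LinearMap.toMatrix b b (𝔥 z) i j) = fun z => b.coord i (𝔥 z (b j)) := by
    funext z; rw [LinearMap.toMatrix_apply, Module.Basis.coord_apply]
  rw [h]
  exact h𝔥 (b.coord i) (b j)

/-- **`z ↦ det 𝔥(z)` is differentiable** for a weakly differentiable `End V`-valued map on a finite-dimensional `V`. [folklore] [cite: BernsteinLapid2019, §4 Claim 1 (p. 9)] -/
theorem differentiableOn_det (b : Module.Basis ι 𝕜 V) {𝔥 : 𝕜 → Module.End 𝕜 V} {S : Set 𝕜}
    (h𝔥 : ∀ (ℓ : Module.Dual 𝕜 V) (v : V), DifferentiableOn 𝕜 (fun z => ℓ (𝔥 z v)) S) :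
    DifferentiableOn 𝕜 (fun z => (LinearMap.toMatrix b b (𝔥 z)).det) S :=
  differentiableOn_matrix_det (differentiableOn_toMatrix_apply b h𝔥)

/-- **Invertibility is the non-vanishing of the determinant** (field case). [folklore] -/
theorem isUnit_iff_det_toMatrix_ne_zero (b : Module.Basis ι 𝕜 V) (f : Module.End 𝕜 V) :
    IsUnit f ↔ (LinearMap.toMatrix b b f).det ≠ 0 := by
  haveI : Module.Finite 𝕜 V := Module.Finite.of_basis b
  haveI : Module.Free 𝕜 V := Module.Free.of_basis b
  rw [LinearMap.isUnit_iff_isUnit_det, ← LinearMap.det_toMatrix b, isUnit_iff_ne_zero]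

/-- **`{z | 𝔥(z) invertible}` IS OPEN** for a weakly differentiable (everywhere) `End V`-valued map on a finite-dimensional `V`. [folklore] [cite: BernsteinLapid2019, §4 Claim 1 (p. 9)] -/
theorem isOpen_setOf_isUnit [FiniteDimensional 𝕜 V] {𝔥 : 𝕜 → Module.End 𝕜 V}
    (h𝔥 : ∀ (ℓ : Module.Dual 𝕜 V) (v : V), Differentiable 𝕜 (fun z => ℓ (𝔥 z v))) :
    IsOpen {z : 𝕜 | IsUnit (𝔥 z)} := by
  classical
  set b := Module.finBasis 𝕜 V with hb
  have hd : Differentiable 𝕜 (fun z => (LinearMap.toMatrix b b (𝔥 z)).det) :=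
    differentiableOn_univ.1 (differentiableOn_det b fun ℓ v => (h𝔥 ℓ v).differentiableOn)
  have hset : {z : 𝕜 | IsUnit (𝔥 z)} = {z : 𝕜 | (LinearMap.toMatrix b b (𝔥 z)).det ≠ 0} := by
    ext z; exact isUnit_iff_det_toMatrix_ne_zero b (𝔥 z)
  rw [hset]
  exact isOpen_ne_fun hd.continuous continuous_const

/-- **The matrix of `Ring.inverse (𝔥 z)` is the matrix inverse** where `𝔥 z` is invertible. [folklore] -/
theorem toMatrix_inverse_eq (b : Module.Basis ι 𝕜 V) {f : Module.End 𝕜 V} (hf : IsUnit f) :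
    LinearMap.toMatrix b b (Ring.inverse f) = (LinearMap.toMatrix b b f)⁻¹ := by
  symm
  apply Matrix.inv_eq_left_inv
  rw [← LinearMap.toMatrix_mul, Ring.inverse_mul_cancel _ hf, LinearMap.toMatrix_one]

/-- **THE COORDINATES OF `𝔥(z)⁻¹ φ` ARE DIFFERENTIABLE ON `S ∩ {𝔥(z) invertible}`**: `b.repr (𝔥(z)⁻¹ φ) i = Σ_j (det⁻¹ · adj)_{ij}(z) · b.repr φ j` (Cramer). [folklore]
[cite: BernsteinLapid2019, §4 Claim 1 (p. 9)] -/
theorem differentiableOn_coord_inverse_apply (b : Module.Basis ι 𝕜 V) {𝔥 : 𝕜 → Module.End 𝕜 V} {S : Set 𝕜}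
    (h𝔥 : ∀ (ℓ : Module.Dual 𝕜 V) (v : V), DifferentiableOn 𝕜 (fun z => ℓ (𝔥 z v)) S) (φ : V) (i : ι) :
    DifferentiableOn 𝕜 (fun z => b.repr (Ring.inverse (𝔥 z) φ) i) (S ∩ {z : 𝕜 | IsUnit (𝔥 z)}) := by
  have hS : S ∩ {z : 𝕜 | IsUnit (𝔥 z)} ⊆ S := inter_subset_left
  -- the coordinates as a Cramer sum
  have hrepr : ∀ z ∈ S ∩ {z : 𝕜 | IsUnit (𝔥 z)}, b.repr (Ring.inverse (𝔥 z) φ) i =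
      ∑ j, ((LinearMap.toMatrix b b (𝔥 z)).det)⁻¹ * (LinearMap.toMatrix b b (𝔥 z)).adjugate i j * b.repr φ j := by
    intro z hz
    have h1 := LinearMap.toMatrix_mulVec_repr b b (Ring.inverse (𝔥 z)) φ
    rw [toMatrix_inverse_eq b hz.2, Matrix.inv_def, Ring.inverse_eq_inv'] at h1
    rw [← h1, Matrix.mulVec, dotProduct]
    refine Finset.sum_congr rfl fun j _ => ?_
    rw [Matrix.smul_apply, smul_eq_mul]
  refine (DifferentiableOn.fun_sum fun j _ => ?_).congr hrepr
  refine DifferentiableOn.mul (DifferentiableOn.mul ?_ ((differentiableOn_matrix_adjugate_apply (differentiableOn_toMatrix_apply b h𝔥) i j).mono hS)) (differentiableOn_const _)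
  exact ((differentiableOn_det b h𝔥).mono hS).inv fun z hz => (isUnit_iff_det_toMatrix_ne_zero b (𝔥 z)).1 hz.2

end FinDim

/-! ## §3 The binders of ★ row 15: `z ↦ Ψ(z)(𝔥(z)⁻¹ φ)` is holomorphic on `U ∩ {𝔥(z) invertible}` -/

section Apply

variable {𝕜 : Type*} [NontriviallyNormedField 𝕜] {V : Type*} [AddCommGroup V] [Module 𝕜 V] [FiniteDimensional 𝕜 V]
  {X : Type*} [NormedAddCommGroup X] [NormedSpace 𝕜 X]

/-- **`z ↦ Ψ(z)(𝔥(z)⁻¹ φ)` IS DIFFERENTIABLE ON `U ∩ {𝔥(z) invertible}`** for a weakly differentiable `𝔥 : 𝕜 → End V` (everywhere), a linear unknown `Ψ(z) : V →ₗ X` differentiable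
vectorwise on `U`, and `φ ∈ V`: `Ψ(z)(𝔥(z)⁻¹φ) = Σ_i c_i(z) • Ψ(z)(b_i)` with the Cramer coordinates `c_i` of §2. [cite: BernsteinLapid2019, §4 Claim 1 (p. 9) and p. 10]
[cite: MoeglinWaldspurger1995, IV.1.3] -/
theorem differentiableOn_apply_inverse_apply {𝔥 : 𝕜 → Module.End 𝕜 V} (h𝔥 : ∀ (ℓ : Module.Dual 𝕜 V) (v : V), Differentiable 𝕜 (fun z => ℓ (𝔥 z v)))
    {Ψ : 𝕜 → (V →ₗ[𝕜] X)} {U : Set 𝕜} (hΨ : ∀ v : V, DifferentiableOn 𝕜 (fun z => Ψ z v) U) (φ : V) :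
    DifferentiableOn 𝕜 (fun z => Ψ z (Ring.inverse (𝔥 z) φ)) (U ∩ {z : 𝕜 | IsUnit (𝔥 z)}) := by
  classical
  set b := Module.finBasis 𝕜 V with hb
  have hsum : (fun z => Ψ z (Ring.inverse (𝔥 z) φ)) = fun z => ∑ i, b.repr (Ring.inverse (𝔥 z) φ) i • Ψ z (b i) := by
    funext z
    conv_lhs => rw [← b.sum_repr (Ring.inverse (𝔥 z) φ)]
    rw [map_sum]
    exact Finset.sum_congr rfl fun i _ => by rw [map_smul]
  rw [hsum]
  refine DifferentiableOn.fun_sum fun i _ => DifferentiableOn.smul ?_ ((hΨ (b i)).mono inter_subset_left)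
  exact differentiableOn_coord_inverse_apply b (fun ℓ v => (h𝔥 ℓ v).differentiableOn) φ i

variable {G : Type*}

/-- **`{z | 𝔥(z) invertible}` IS OPEN — FUNCTION-SPACE PRINT** in exactly the hypotheses of ★ p859566 `exists_heckeEnd_cm` (pointwise holomorphy `z ↦ (𝔥 z ψ)(x)` for all `ψ`, `x`):
the binder `h𝔥o` of ★ row 15 `exists_truncatedFamily_chi_cm_two`. [cite: BernsteinLapid2019, §4 Claim 1 (p. 9)] [cite: MoeglinWaldspurger1995, I.2.17] -/
theorem isOpen_setOf_isUnit_of_eval (W : Submodule 𝕜 (G → 𝕜)) [FiniteDimensional 𝕜 ↥W] {𝔥 : 𝕜 → Module.End 𝕜 ↥W}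
    (h𝔥 : ∀ (ψ : ↥W) (x : G), Differentiable 𝕜 fun z => ((𝔥 z ψ : ↥W) : G → 𝕜) x) :
    IsOpen {z : 𝕜 | IsUnit (𝔥 z)} :=
  isOpen_setOf_isUnit fun ℓ ψ => differentiableOn_univ.1
    (differentiableOn_dual_apply_of_eval W (f := fun z => 𝔥 z ψ) (fun x => (h𝔥 ψ x).differentiableOn) ℓ)

/-- **`z ↦ Ψ(z)(𝔥(z)⁻¹ φ)` IS HOLOMORPHIC ON `U ∩ {𝔥(z) invertible}` — FUNCTION-SPACE PRINT** in exactly the hypotheses of ★ p859566 (pointwise holomorphy of `𝔥`) and vectorwise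
holomorphy of the linear unknown `Ψ(z) : W →ₗ X` on `U`: the binder `hΨ` of ★ row 15 `exists_truncatedFamily_chi_cm_two`. [cite: BernsteinLapid2019, §4 Claim 1 (p. 9) and p. 10]
[cite: MoeglinWaldspurger1995, I.2.17, IV.1.3] -/
theorem differentiableOn_apply_inverse_apply_of_eval (W : Submodule 𝕜 (G → 𝕜)) [FiniteDimensional 𝕜 ↥W] {𝔥 : 𝕜 → Module.End 𝕜 ↥W}
    (h𝔥 : ∀ (ψ : ↥W) (x : G), Differentiable 𝕜 fun z => ((𝔥 z ψ : ↥W) : G → 𝕜) x)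
    {Ψ : 𝕜 → (↥W →ₗ[𝕜] X)} {U : Set 𝕜} (hΨ : ∀ ψ : ↥W, DifferentiableOn 𝕜 (fun z => Ψ z ψ) U) (φ : ↥W) :
    DifferentiableOn 𝕜 (fun z => Ψ z (Ring.inverse (𝔥 z) φ)) (U ∩ {z : 𝕜 | IsUnit (𝔥 z)}) :=
  differentiableOn_apply_inverse_apply (fun ℓ ψ => differentiableOn_univ.1
    (differentiableOn_dual_apply_of_eval W (f := fun z => 𝔥 z ψ) (fun x => (h𝔥 ψ x).differentiableOn) ℓ)) hΨ φ

end Apply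

end Summit.HodgeConjecture.HodgeConjecture.Cruxes.H413.K2E1ChiHeckeMatrixInverseHolomorphic

end
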